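/-
Copyright (c) 2026. All rights reserved.
Released under Apache 2.0 license as described in the file LICENSE.
Authors: HodgeCM publication cell (pub-hodgecm), GR lane, seat GR-2 (`pub-hodgecm-own-hyp34`).
-/
import Mathlib.Analysis.Normed.Operator.Extend
import Mathlib.Analysis.Complex.Basic
import Mathlib.Topology.UniformSpace.UniformApproximation
import Mathlib.Topology.DenseEmbedding
import Mathlib.Algebra.Module.Equiv.Basic
import HarnessLib

/-!
# Operators isometric UP TO A POSITIVE SCALAR along a dense embedding: the normalised unitary extension

Topic `RepresentationTheory/Unitary`; namespace `Literature.RepresentationTheory.Unitary`.  KERNEL ONLY (Mathlib only):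
definitions with bodies and proved theorems; no named fact, no `sorry`.

[Weil1964, Chap. I n° 13 p. 160] writes every metaplectic operator on the smooth model `𝒮(X)` as a scalar times a product
of explicit operators (`Φ ↦ Φ ∘ α⁻¹`, second-degree characters, partial Fourier transforms), each of which multiplies
the `L²` norm by a positive constant (`|det α|^{1/2}`, `1`, the Plancherel constant of the chosen Haar measure), and
[Weil1964, Chap. III n° 34–37] / [GelbartRogawski1991, §3.1 p. 454 L21–27] then work with the UNITARY operators
`M_g` on the Hilbert space of `ρ_ψ`: the passage is "divide by the constant, extend by density".  This file isolates that
passage as Hilbert-space algebra, for an ABSTRACT dense linear embedding `i : E →ₗ[ℂ] H` of a complex vector space `E`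
(the smooth vectors) into a complete normed space `H` (the `L²` space):

* §1 **`scaledIsometries i`** — the SUBGROUP of `E ≃ₗ[ℂ] E` of the automorphisms `M` with `‖i (M x)‖ = r ‖i x‖` for
  ONE constant `r > 0` (closed under products and inverses).  Consequence for the consumer: to know that EVERY element
  of a group acting on `E` is a scaled isometry it suffices to check GENERATORS (e.g. via
  `Weil1964.adelicMpCont.eq_top_of_generators_mem` applied to `(scaledIsometries i).comap ω`).
* §2 **`scale i M`** — THE constant (`= 1` off the subgroup or when `i = 0`); `norm_apply_eq_scale_mul`, and the character
  property `scale_one`, `scale_mul`, `scale_inv`; `scaleUnit : scaledIsometries i →* ℂˣ`.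
* §3 **`normalize i M := (scale i M)⁻¹ • M`** is an EXACT `i`-isometry and `normalizeHom : scaledIsometries i →* (E ≃ₗ[ℂ] E)`
  is a homomorphism.
* §4 **`unitaryExt i hd M : H ≃ₗᵢ[ℂ] H`** (`hd : DenseRange i`) — the unique surjective linear isometry of `H` with
  `unitaryExt i hd M (i x) = (scale i M)⁻¹ • i (M x)`; uniqueness against any continuous map agreeing on `range i`;
  **`unitaryExtHom i hd : scaledIsometries i →* (H ≃ₗᵢ[ℂ] H)`** and, for a homomorphism `ω : G →* (E ≃ₗ[ℂ] E)` with values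
  in `scaledIsometries i`, **`unitaryRep i hd ω hω : G →* (H ≃ₗᵢ[ℂ] H)`** — the kernel of "normalise and extend" is exactly
  the positive scalars (`unitaryExt_toLinearEquiv_smul`: `c • id ↦ (c / ‖c‖) • id`).
* §5 **intertwining transfer** `unitaryExt_apply_eq_of_semiconj`: an `E`-level relation `M ∘ a = b ∘ M` under continuous
  linear maps `A ⊇ i ∘ a`, `B ⊇ i ∘ b` of `H` gives `unitaryExt M ∘ A = B ∘ unitaryExt M` (density) — the form in which
  "`M ρ(h) M⁻¹ = ρ(g h)` on `𝒮`" becomes the printed relation for the unitary extension on the Hilbert space.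
* §6 **strong continuity** `continuous_unitaryExt_apply`: along any map `s : Z → scaledIsometries i`, continuity of the
  `E`-level orbit maps `z ↦ i (s z x)` in `H` gives continuity of `z ↦ scale i (s z)` and of every `z ↦ unitaryExt (s z) f`,
  `f ∈ H` (uniform approximation by isometries).

## References
* [Weil1964] A. Weil, *Sur certains groupes d'opérateurs unitaires*, Acta Math. 111 (1964) 143–211, Chap. I n° 13
  p. 160, Chap. III n° 34–37.
* [GelbartRogawski1991] S. Gelbart, J. Rogawski, Invent. Math. 105 (1991) 445–472, §3.1 p. 454 L21–27.
-/

set_option autoImplicit false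

noncomputable section

open Filter Topology

namespace Literature.RepresentationTheory.Unitary

variable {E : Type*} [AddCommGroup E] [Module ℂ E]
variable {H : Type*} [NormedAddCommGroup H] [NormedSpace ℂ H]
variable (i : E →ₗ[ℂ] H)

/-! ## §1 The subgroup of scaled isometries -/

/-- **the scaled `i`-isometries**: the linear automorphisms `M` of `E` with `‖i (M x)‖ = r ‖i x‖` for all `x` and one
constant `r > 0` — a subgroup of `E ≃ₗ[ℂ] E` (products multiply the constants, inverses invert them).
[cite: Weil1964, Chap. I n° 13 p. 160] -/
def scaledIsometries : Subgroup (E ≃ₗ[ℂ] E) where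
  carrier := {M | ∃ r : ℝ, 0 < r ∧ ∀ x, ‖i (M x)‖ = r * ‖i x‖}
  mul_mem' := by
    rintro M M' ⟨r, hr, hM⟩ ⟨r', hr', hM'⟩
    exact ⟨r * r', mul_pos hr hr', fun x => by rw [LinearEquiv.mul_apply, hM, hM', mul_assoc]⟩
  one_mem' := ⟨1, one_pos, fun x => by rw [one_mul]; rfl⟩
  inv_mem' := by
    rintro M ⟨r, hr, hM⟩
    refine ⟨r⁻¹, inv_pos.2 hr, fun x => ?_⟩
    have h := hM (M⁻¹ x)
    rw [LinearEquiv.coe_inv, LinearEquiv.apply_symm_apply] at h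
    rw [LinearEquiv.coe_inv, h, ← mul_assoc, inv_mul_cancel₀ hr.ne', one_mul]

/-- membership in `scaledIsometries i`. [cite: Weil1964, Chap. I n° 13 p. 160] -/
theorem mem_scaledIsometries_iff (M : E ≃ₗ[ℂ] E) :
    M ∈ scaledIsometries i ↔ ∃ r : ℝ, 0 < r ∧ ∀ x, ‖i (M x)‖ = r * ‖i x‖ :=
  Iff.rfl

/-- an exact `i`-isometry is a scaled isometry. [cite: Weil1964, Chap. I n° 13 p. 160] -/
theorem mem_scaledIsometries_of_norm_eq {M : E ≃ₗ[ℂ] E} (h : ∀ x, ‖i (M x)‖ = ‖i x‖) :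
    M ∈ scaledIsometries i :=
  ⟨1, one_pos, fun x => by rw [h, one_mul]⟩

/-- the scalar `c • id`, `c ∈ ℂˣ`, is a scaled isometry (constant `‖c‖`). [cite: Weil1964, Chap. I n° 13 p. 160] -/
theorem toLinearEquiv_mem_scaledIsometries (c : ℂˣ) :
    DistribMulAction.toLinearEquiv ℂ E c ∈ scaledIsometries i :=
  ⟨‖(c : ℂ)‖, norm_pos_iff.2 c.ne_zero, fun x => by
    rw [DistribMulAction.toLinearEquiv_apply, Units.smul_def, map_smul, norm_smul]⟩

/-- a homomorphism `ω : G → (E ≃ₗ[ℂ] E)` takes values in the scaled isometries iff the pulled-back subgroup is everything —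
the form in which a structure theorem "`G` is generated by …" is consumed. [cite: Weil1964, Chap. I n° 13 p. 160] -/
theorem comap_scaledIsometries_eq_top_iff {G : Type*} [Group G] (ω : G →* (E ≃ₗ[ℂ] E)) :
    (scaledIsometries i).comap ω = ⊤ ↔ ∀ g, ω g ∈ scaledIsometries i := by
  rw [Subgroup.eq_top_iff']
  exact Iff.rfl

/-! ## §2 The scale -/

/-- **the scale of `M`**: the constant `r > 0` with `‖i (M x)‖ = r ‖i x‖` when `M` is a scaled isometry and `i ≠ 0`
(then it is unique), and `1` otherwise. [cite: Weil1964, Chap. I n° 13 p. 160] -/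
def scale (M : E ≃ₗ[ℂ] E) : ℝ :=
  haveI := Classical.propDecidable (M ∈ scaledIsometries i ∧ ∃ x, i x ≠ 0)
  if h : M ∈ scaledIsometries i ∧ ∃ x, i x ≠ 0 then Classical.choose h.1 else 1

/-- the scale is positive. [cite: Weil1964, Chap. I n° 13 p. 160] -/
theorem scale_pos (M : E ≃ₗ[ℂ] E) : 0 < scale i M := by
  unfold scale
  split_ifs with h
  · exact (Classical.choose_spec h.1).1
  · exact one_pos

/-- the scale is non-zero. [cite: Weil1964, Chap. I n° 13 p. 160] -/
theorem scale_ne_zero (M : E ≃ₗ[ℂ] E) : scale i M ≠ 0 := (scale_pos i M).ne'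

/-- **`‖i (M x)‖ = scale M · ‖i x‖`** for a scaled isometry `M`. [cite: Weil1964, Chap. I n° 13 p. 160] -/
theorem norm_apply_eq_scale_mul {M : E ≃ₗ[ℂ] E} (hM : M ∈ scaledIsometries i) (x : E) :
    ‖i (M x)‖ = scale i M * ‖i x‖ := by
  unfold scale
  split_ifs with h
  · exact (Classical.choose_spec h.1).2 x
  · have h0 : ∀ y, i y = 0 := fun y => by
      by_contra hy
      exact h ⟨hM, y, hy⟩
    rw [h0, h0, norm_zero, mul_zero]

/-- uniqueness of the constant: if `‖i (M x)‖ = r ‖i x‖` for all `x` with `r > 0` and `i ≠ 0`, then `scale M = r`.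
[cite: Weil1964, Chap. I n° 13 p. 160] -/
theorem scale_eq_of_norm_apply_eq {M : E ≃ₗ[ℂ] E} {r : ℝ} (hr : 0 < r) (h : ∀ x, ‖i (M x)‖ = r * ‖i x‖)
    (hi : ∃ x, i x ≠ 0) : scale i M = r := by
  obtain ⟨x, hx⟩ := hi
  exact mul_right_cancel₀ (norm_ne_zero_iff.2 hx) ((norm_apply_eq_scale_mul i ⟨r, hr, h⟩ x).symm.trans (h x))

/-- the scale when `i = 0` is `1`. [cite: Weil1964, Chap. I n° 13 p. 160] -/
theorem scale_eq_one_of_forall_eq_zero {M : E ≃ₗ[ℂ] E} (hi : ∀ x, i x = 0) : scale i M = 1 := by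
  unfold scale
  rw [dif_neg]
  rintro ⟨-, x, hx⟩
  exact hx (hi x)

/-- `scale 1 = 1`. [cite: Weil1964, Chap. I n° 13 p. 160] -/
@[simp] theorem scale_one : scale i (1 : E ≃ₗ[ℂ] E) = 1 := by
  by_cases hi : ∃ x, i x ≠ 0
  · exact scale_eq_of_norm_apply_eq i one_pos (fun x => by rw [one_mul]; rfl) hi
  · push Not at hi
    exact scale_eq_one_of_forall_eq_zero i hi

/-- **`scale (M M') = scale M · scale M'`** on scaled isometries. [cite: Weil1964, Chap. I n° 13 p. 160] -/
theorem scale_mul {M M' : E ≃ₗ[ℂ] E} (hM : M ∈ scaledIsometries i) (hM' : M' ∈ scaledIsometries i) :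
    scale i (M * M') = scale i M * scale i M' := by
  by_cases hi : ∃ x, i x ≠ 0
  · exact scale_eq_of_norm_apply_eq i (mul_pos (scale_pos i M) (scale_pos i M')) (fun x => by
      rw [LinearEquiv.mul_apply, norm_apply_eq_scale_mul i hM, norm_apply_eq_scale_mul i hM', mul_assoc]) hi
  · push Not at hi
    rw [scale_eq_one_of_forall_eq_zero i hi, scale_eq_one_of_forall_eq_zero i hi,
      scale_eq_one_of_forall_eq_zero i hi, mul_one]

/-- **`scale M⁻¹ = (scale M)⁻¹`** on scaled isometries. [cite: Weil1964, Chap. I n° 13 p. 160] -/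
theorem scale_inv {M : E ≃ₗ[ℂ] E} (hM : M ∈ scaledIsometries i) : scale i M⁻¹ = (scale i M)⁻¹ := by
  have h := scale_mul i ((scaledIsometries i).inv_mem hM) hM
  rw [inv_mul_cancel, scale_one] at h
  exact eq_inv_of_mul_eq_one_left h.symm

/-- the scale of an exact isometry is `1`. [cite: Weil1964, Chap. I n° 13 p. 160] -/
theorem scale_eq_one_of_norm_eq {M : E ≃ₗ[ℂ] E} (h : ∀ x, ‖i (M x)‖ = ‖i x‖) : scale i M = 1 := by
  by_cases hi : ∃ x, i x ≠ 0
  · exact scale_eq_of_norm_apply_eq i one_pos (fun x => by rw [h, one_mul]) hi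
  · push Not at hi
    exact scale_eq_one_of_forall_eq_zero i hi

/-- the scale of the scalar `c • id` is `‖c‖` (when `i ≠ 0`). [cite: Weil1964, Chap. I n° 13 p. 160] -/
theorem scale_toLinearEquiv (c : ℂˣ) (hi : ∃ x, i x ≠ 0) :
    scale i (DistribMulAction.toLinearEquiv ℂ E c) = ‖(c : ℂ)‖ :=
  scale_eq_of_norm_apply_eq i (norm_pos_iff.2 c.ne_zero)
    (fun x => by rw [DistribMulAction.toLinearEquiv_apply, Units.smul_def, map_smul, norm_smul]) hi

/-- the scale as a unit of `ℂ`. [cite: Weil1964, Chap. I n° 13 p. 160] -/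
def scaleUnitOf (M : E ≃ₗ[ℂ] E) : ℂˣ :=
  Units.mk0 (scale i M : ℂ) (Complex.ofReal_ne_zero.2 (scale_ne_zero i M))

/-- the value of `scaleUnitOf`. [cite: Weil1964, Chap. I n° 13 p. 160] -/
@[simp] theorem coe_scaleUnitOf (M : E ≃ₗ[ℂ] E) : (scaleUnitOf i M : ℂ) = (scale i M : ℂ) := rfl

/-- **the scale character `scaledIsometries i →* ℂˣ`**, `M ↦ scale M`. [cite: Weil1964, Chap. I n° 13 p. 160] -/
def scaleUnit : scaledIsometries i →* ℂˣ where
  toFun M := scaleUnitOf i M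
  map_one' := Units.ext (by
    rw [coe_scaleUnitOf, Units.val_one, Complex.ofReal_eq_one]
    exact scale_one i)
  map_mul' M M' := Units.ext (by
    rw [Units.val_mul, coe_scaleUnitOf, coe_scaleUnitOf, coe_scaleUnitOf, ← Complex.ofReal_mul,
      Complex.ofReal_inj]
    exact scale_mul i M.2 M'.2)

/-- the value of the scale character. [cite: Weil1964, Chap. I n° 13 p. 160] -/
@[simp] theorem coe_scaleUnit_apply (M : scaledIsometries i) :
    (scaleUnit i M : ℂ) = (scale i (M : E ≃ₗ[ℂ] E) : ℂ) := rfl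

/-! ## §3 The normalised operator -/

/-- **the normalised operator `(scale M)⁻¹ • M`**. [cite: Weil1964, Chap. I n° 13 p. 160] -/
def normalize (M : E ≃ₗ[ℂ] E) : E ≃ₗ[ℂ] E :=
  DistribMulAction.toLinearEquiv ℂ E (scaleUnitOf i M)⁻¹ * M

/-- formula: `normalize M x = (scale M)⁻¹ • M x`. [cite: Weil1964, Chap. I n° 13 p. 160] -/
theorem normalize_apply (M : E ≃ₗ[ℂ] E) (x : E) :
    normalize i M x = ((scale i M : ℂ)⁻¹) • M x := by
  rw [normalize, LinearEquiv.mul_apply, DistribMulAction.toLinearEquiv_apply, Units.smul_def, Units.val_inv_eq_inv_val,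
    coe_scaleUnitOf]

/-- **the normalised operator of a scaled isometry is an EXACT `i`-isometry**: `‖i (normalize M x)‖ = ‖i x‖`.
[cite: Weil1964, Chap. I n° 13 p. 160] -/
theorem norm_normalize_apply {M : E ≃ₗ[ℂ] E} (hM : M ∈ scaledIsometries i) (x : E) :
    ‖i (normalize i M x)‖ = ‖i x‖ := by
  rw [normalize_apply, map_smul, norm_smul, norm_inv, Complex.norm_real, Real.norm_of_nonneg (scale_pos i M).le,
    norm_apply_eq_scale_mul i hM, ← mul_assoc, inv_mul_cancel₀ (scale_ne_zero i M), one_mul]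

/-- the normalised operator of an exact isometry is the operator. [cite: Weil1964, Chap. I n° 13 p. 160] -/
theorem normalize_eq_self_of_norm_eq {M : E ≃ₗ[ℂ] E} (h : ∀ x, ‖i (M x)‖ = ‖i x‖) : normalize i M = M :=
  LinearEquiv.ext fun x => by
    rw [normalize_apply, scale_eq_one_of_norm_eq i h, Complex.ofReal_one, inv_one, one_smul]

/-- `normalize 1 = 1`. [cite: Weil1964, Chap. I n° 13 p. 160] -/
@[simp] theorem normalize_one : normalize i (1 : E ≃ₗ[ℂ] E) = 1 :=
  normalize_eq_self_of_norm_eq i fun _ => rfl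

/-- **`normalize (M M') = normalize M * normalize M'`** on scaled isometries. [cite: Weil1964, Chap. I n° 13 p. 160] -/
theorem normalize_mul {M M' : E ≃ₗ[ℂ] E} (hM : M ∈ scaledIsometries i) (hM' : M' ∈ scaledIsometries i) :
    normalize i (M * M') = normalize i M * normalize i M' :=
  LinearEquiv.ext fun x => by
    rw [normalize_apply, LinearEquiv.mul_apply, LinearEquiv.mul_apply, normalize_apply, normalize_apply, map_smul,
      smul_smul, scale_mul i hM hM', Complex.ofReal_mul, mul_inv]

/-- **the normalisation homomorphism `scaledIsometries i →* (E ≃ₗ[ℂ] E)`**. [cite: Weil1964, Chap. I n° 13 p. 160] -/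
def normalizeHom : scaledIsometries i →* (E ≃ₗ[ℂ] E) where
  toFun M := normalize i M
  map_one' := normalize_one i
  map_mul' M M' := normalize_mul i M.2 M'.2

/-- the value of the normalisation homomorphism. [cite: Weil1964, Chap. I n° 13 p. 160] -/
@[simp] theorem normalizeHom_apply (M : scaledIsometries i) : normalizeHom i M = normalize i M := rfl

/-! ## §4 The unitary extension -/

section Extension

variable [CompleteSpace H] (hd : DenseRange i)

/-- **the unitary extension of a scaled isometry**: the surjective linear isometry of `H` extending
`i x ↦ (scale M)⁻¹ • i (M x)` (Mathlib `LinearEquiv.extendOfIsometry` applied to `normalize M` along the dense `i`).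
[cite: Weil1964, Chap. I n° 13 p. 160; GelbartRogawski1991, §3.1 p. 454 L21–24] -/
def unitaryExt (M : scaledIsometries i) : H ≃ₗᵢ[ℂ] H :=
  (normalize i M).extendOfIsometry i i hd hd (norm_normalize_apply i M.2)

/-- **`unitaryExt M (i x) = (scale M)⁻¹ • i (M x)`**. [cite: Weil1964, Chap. I n° 13 p. 160] -/
@[simp] theorem unitaryExt_apply (M : scaledIsometries i) (x : E) :
    unitaryExt i hd M (i x) = ((scale i (M : E ≃ₗ[ℂ] E) : ℂ)⁻¹) • i ((M : E ≃ₗ[ℂ] E) x) := by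
  rw [unitaryExt, LinearEquiv.extendOfIsometry_eq, normalize_apply, map_smul]

/-- the unitary extension of an EXACT isometry extends the operator itself: `unitaryExt M (i x) = i (M x)`.
[cite: Weil1964, Chap. I n° 13 p. 160] -/
theorem unitaryExt_apply_of_norm_eq (M : scaledIsometries i) (h : ∀ x, ‖i ((M : E ≃ₗ[ℂ] E) x)‖ = ‖i x‖) (x : E) :
    unitaryExt i hd M (i x) = i ((M : E ≃ₗ[ℂ] E) x) := by
  rw [unitaryExt_apply, scale_eq_one_of_norm_eq i h, Complex.ofReal_one, inv_one, one_smul]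

/-- **uniqueness**: a continuous self-map of `H` agreeing with `i x ↦ (scale M)⁻¹ • i (M x)` on `range i` is `unitaryExt M`.
[cite: Weil1964, Chap. I n° 13 p. 160] -/
theorem eq_unitaryExt_of_apply (M : scaledIsometries i) {T : H → H} (hT : Continuous T)
    (h : ∀ x, T (i x) = ((scale i (M : E ≃ₗ[ℂ] E) : ℂ)⁻¹) • i ((M : E ≃ₗ[ℂ] E) x)) : T = unitaryExt i hd M :=
  hd.equalizer hT (unitaryExt i hd M).continuous (funext fun x => by
    rw [Function.comp_apply, Function.comp_apply, h, unitaryExt_apply])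

/-- `unitaryExt 1 = 1`. [cite: Weil1964, Chap. I n° 13 p. 160] -/
theorem unitaryExt_one : unitaryExt i hd 1 = 1 := by
  refine LinearIsometryEquiv.ext fun f => ?_
  have h := eq_unitaryExt_of_apply i hd 1 (T := id) continuous_id fun x => by
    rw [id, Subgroup.coe_one, scale_one, Complex.ofReal_one, inv_one, one_smul]
    rfl
  exact (congrFun h f).symm

/-- **`unitaryExt (M M') = unitaryExt M * unitaryExt M'`**. [cite: Weil1964, Chap. I n° 13 p. 160] -/
theorem unitaryExt_mul (M M' : scaledIsometries i) :
    unitaryExt i hd (M * M') = unitaryExt i hd M * unitaryExt i hd M' := by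
  refine LinearIsometryEquiv.ext fun f => ?_
  have h := eq_unitaryExt_of_apply i hd (M * M') (T := fun f => unitaryExt i hd M (unitaryExt i hd M' f))
    ((unitaryExt i hd M).continuous.comp (unitaryExt i hd M').continuous) fun x => by
      rw [unitaryExt_apply, map_smul, unitaryExt_apply, smul_smul, Subgroup.coe_mul, LinearEquiv.mul_apply,
        scale_mul i M.2 M'.2, Complex.ofReal_mul, mul_inv, mul_comm]
  exact (congrFun h f).symm

/-- `unitaryExt M⁻¹ = (unitaryExt M)⁻¹`. [cite: Weil1964, Chap. I n° 13 p. 160] -/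
theorem unitaryExt_inv (M : scaledIsometries i) : unitaryExt i hd M⁻¹ = (unitaryExt i hd M)⁻¹ :=
  eq_inv_of_mul_eq_one_left (by rw [← unitaryExt_mul, inv_mul_cancel, unitaryExt_one])

/-- **the unitary extension homomorphism `scaledIsometries i →* (H ≃ₗᵢ[ℂ] H)`**. [cite: Weil1964, Chap. I n° 13 p. 160;
GelbartRogawski1991, §3.1 p. 454 L21–27] -/
def unitaryExtHom : scaledIsometries i →* (H ≃ₗᵢ[ℂ] H) where
  toFun := unitaryExt i hd
  map_one' := unitaryExt_one i hd
  map_mul' := unitaryExt_mul i hd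

/-- the value of the unitary extension homomorphism. [cite: Weil1964, Chap. I n° 13 p. 160] -/
@[simp] theorem unitaryExtHom_apply (M : scaledIsometries i) : unitaryExtHom i hd M = unitaryExt i hd M := rfl

/-- unitarity, norm form. [cite: Weil1964, Chap. I n° 13 p. 160] -/
theorem norm_unitaryExt_apply (M : scaledIsometries i) (f : H) : ‖unitaryExt i hd M f‖ = ‖f‖ :=
  (unitaryExt i hd M).norm_map f

/-- the unitary extension is onto. [cite: Weil1964, Chap. I n° 13 p. 160] -/
theorem surjective_unitaryExt (M : scaledIsometries i) : Function.Surjective (unitaryExt i hd M) :=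
  (unitaryExt i hd M).surjective

/-- **the kernel of "normalise and extend" is the positive scalars**: the scalar `c • id`, `c ∈ ℂˣ`, extends to the unit scalar
`(c / ‖c‖) • id` of `H`. [cite: Weil1964, Chap. I n° 13 p. 160; GelbartRogawski1991, §3.1 p. 454 L26–27] -/
theorem unitaryExt_toLinearEquiv_smul (c : ℂˣ) (f : H) :
    unitaryExt i hd ⟨DistribMulAction.toLinearEquiv ℂ E c, toLinearEquiv_mem_scaledIsometries i c⟩ f =
      ((‖(c : ℂ)‖ : ℂ)⁻¹ * c) • f := by
  have h := eq_unitaryExt_of_apply i hd ⟨DistribMulAction.toLinearEquiv ℂ E c, toLinearEquiv_mem_scaledIsometries i c⟩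
    (T := fun f : H => ((‖(c : ℂ)‖ : ℂ)⁻¹ * c) • f) (continuous_const_smul _) fun x => by
      by_cases hi : ∃ x, i x ≠ 0
      · rw [scale_toLinearEquiv i c hi, DistribMulAction.toLinearEquiv_apply, Units.smul_def, map_smul, smul_smul]
      · push Not at hi
        rw [hi, hi, smul_zero, smul_zero]
  exact (congrFun h f).symm

end Extension

/-! ### The unitary representation of a group acting by scaled isometries -/

section Rep

variable [CompleteSpace H] (hd : DenseRange i) {G : Type*} [Group G] (ω : G →* (E ≃ₗ[ℂ] E))
  (hω : ∀ g, ω g ∈ scaledIsometries i)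

/-- **the unitary representation on `H` of a group acting on `E` by scaled `i`-isometries**: `g ↦ unitaryExt (ω g)`.
[cite: Weil1964, Chap. I n° 13 p. 160; GelbartRogawski1991, §3.1 p. 454 L21–27] -/
def unitaryRep : G →* (H ≃ₗᵢ[ℂ] H) :=
  (unitaryExtHom i hd).comp (ω.codRestrict (scaledIsometries i) hω)

/-- the value of the unitary representation. [cite: Weil1964, Chap. I n° 13 p. 160] -/
theorem unitaryRep_apply (g : G) : unitaryRep i hd ω hω g = unitaryExt i hd ⟨ω g, hω g⟩ := rfl

/-- **`unitaryRep g (i x) = (scale (ω g))⁻¹ • i (ω g x)`**. [cite: Weil1964, Chap. I n° 13 p. 160] -/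
@[simp] theorem unitaryRep_apply_apply (g : G) (x : E) :
    unitaryRep i hd ω hω g (i x) = ((scale i (ω g) : ℂ)⁻¹) • i (ω g x) :=
  unitaryExt_apply i hd ⟨ω g, hω g⟩ x

/-- unitarity of the representation, norm form. [cite: Weil1964, Chap. I n° 13 p. 160] -/
theorem norm_unitaryRep_apply (g : G) (f : H) : ‖unitaryRep i hd ω hω g f‖ = ‖f‖ :=
  (unitaryRep i hd ω hω g).norm_map f

omit [CompleteSpace H] in
include hω in
/-- **the scale along `ω` is a character**: `g ↦ scale (ω g)` is multiplicative. [cite: Weil1964, Chap. I n° 13 p. 160] -/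
theorem scale_map_mul (g g' : G) : scale i (ω (g * g')) = scale i (ω g) * scale i (ω g') := by
  rw [map_mul, scale_mul i (hω g) (hω g')]

end Rep

/-! ## §5 Intertwining relations pass to the extension -/

section Semiconj

variable [CompleteSpace H] (hd : DenseRange i)

/-- **intertwining transfer**: if `M (a x) = b (M x)` on `E` and `A`, `B` are continuous linear maps of `H` extending `a`, `b`
along `i`, then `unitaryExt M (A f) = B (unitaryExt M f)` for all `f ∈ H` — e.g. `a = ρ(h)`, `b = ρ(g h)` on the smooth vectors
and `A`, `B` the unitary operators `ρ_ψ(h)`, `ρ_ψ(g h)` on the Hilbert space: the pair `(g, unitaryExt M)` satisfies the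
printed relation `M_g ρ_ψ(h) M_g⁻¹ = ρ_ψ(g h)`. [cite: GelbartRogawski1991, §3.1 p. 454 L21–24; Weil1964, Chap. I n° 13
p. 160] -/
theorem unitaryExt_apply_eq_of_semiconj (M : scaledIsometries i) {a b : E → E} {A B : H →ₗ[ℂ] H}
    (hA : Continuous A) (hB : Continuous B) (hAa : ∀ x, A (i x) = i (a x)) (hBb : ∀ x, B (i x) = i (b x))
    (hab : ∀ x, (M : E ≃ₗ[ℂ] E) (a x) = b ((M : E ≃ₗ[ℂ] E) x)) (f : H) :
    unitaryExt i hd M (A f) = B (unitaryExt i hd M f) := by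
  have h := hd.equalizer ((unitaryExt i hd M).continuous.comp hA) (hB.comp (unitaryExt i hd M).continuous)
    (funext fun x => by
      rw [Function.comp_apply, Function.comp_apply, Function.comp_apply, Function.comp_apply, hAa, unitaryExt_apply,
        hab, unitaryExt_apply, map_smul, hBb])
  exact congrFun h f

/-- the same for a group action `ω` by scaled isometries. [cite: GelbartRogawski1991, §3.1 p. 454 L21–24; Weil1964, Chap. I
n° 13 p. 160] -/
theorem unitaryRep_apply_eq_of_semiconj {G : Type*} [Group G] (ω : G →* (E ≃ₗ[ℂ] E))
    (hω : ∀ g, ω g ∈ scaledIsometries i) (g : G) {a b : E → E} {A B : H →ₗ[ℂ] H}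
    (hA : Continuous A) (hB : Continuous B) (hAa : ∀ x, A (i x) = i (a x)) (hBb : ∀ x, B (i x) = i (b x))
    (hab : ∀ x, ω g (a x) = b (ω g x)) (f : H) :
    unitaryRep i hd ω hω g (A f) = B (unitaryRep i hd ω hω g f) :=
  unitaryExt_apply_eq_of_semiconj i hd ⟨ω g, hω g⟩ hA hB hAa hBb hab f

end Semiconj

/-! ## §6 Strong continuity along a map -/

section Continuity

variable {Z : Type*} [TopologicalSpace Z] (s : Z → scaledIsometries i)

/-- **the scale is continuous along `s`** as soon as the `E`-level orbit maps `z ↦ i (s z x)` are continuous in `H`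
(`scale (s z) = ‖i (s z x)‖ / ‖i x‖` for any `x` with `i x ≠ 0`). [cite: Weil1964, Chap. I n° 13 p. 160] -/
theorem continuous_scale_comp (hs : ∀ x, Continuous fun z => i ((s z : E ≃ₗ[ℂ] E) x)) :
    Continuous fun z => scale i (s z : E ≃ₗ[ℂ] E) := by
  by_cases hi : ∃ x, i x ≠ 0
  · obtain ⟨x, hx⟩ := hi
    have hx' : ‖i x‖ ≠ 0 := norm_ne_zero_iff.2 hx
    have h : (fun z => scale i (s z : E ≃ₗ[ℂ] E)) = fun z => ‖i ((s z : E ≃ₗ[ℂ] E) x)‖ / ‖i x‖ := funext fun z => by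
      rw [norm_apply_eq_scale_mul i (s z).2, mul_div_cancel_right₀ _ hx']
    rw [h]
    exact (hs x).norm.div_const _
  · push Not at hi
    have h : (fun z => scale i (s z : E ≃ₗ[ℂ] E)) = fun _ => 1 := funext fun z => scale_eq_one_of_forall_eq_zero i hi
    rw [h]
    exact continuous_const

variable [CompleteSpace H] (hd : DenseRange i)

/-- **strong continuity of the unitary extensions along `s`**: if the `E`-level orbit maps `z ↦ i (s z x)` are continuous in
`H`, then so is every `z ↦ unitaryExt (s z) f`, `f ∈ H` — a uniform limit of the continuous `z ↦ unitaryExt (s z) (i x)`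
since the `unitaryExt (s z)` are isometries. [cite: Weil1964, Chap. I n° 13 p. 160; GelbartRogawski1991, Prop. 3.1.1
p. 455 L1–2 ("continuous")] -/
theorem continuous_unitaryExt_apply (hs : ∀ x, Continuous fun z => i ((s z : E ≃ₗ[ℂ] E) x)) (f : H) :
    Continuous fun z => unitaryExt i hd (s z) f := by
  refine continuous_of_uniform_approx_of_continuous fun u hu => ?_
  obtain ⟨ε, hε, hεu⟩ := Metric.mem_uniformity_dist.1 hu
  obtain ⟨x, hx⟩ := Metric.denseRange_iff.1 hd f ε hε
  refine ⟨fun z => unitaryExt i hd (s z) (i x), ?_, fun z => hεu ?_⟩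
  · simp only [unitaryExt_apply]
    exact ((Complex.continuous_ofReal.comp (continuous_scale_comp i s hs)).inv₀ fun z =>
      Complex.ofReal_ne_zero.2 (scale_ne_zero i _)).smul (hs x)
  · rw [dist_eq_norm, ← map_sub, norm_unitaryExt_apply, ← dist_eq_norm]
    exact hx

/-- the same for a group action `ω` by scaled isometries, along any map `s : Z → G` (e.g. a section over a subgroup).
[cite: Weil1964, Chap. I n° 13 p. 160; GelbartRogawski1991, Prop. 3.1.1 p. 455 L1–2] -/
theorem continuous_unitaryRep_comp_apply {G : Type*} [Group G] (ω : G →* (E ≃ₗ[ℂ] E))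
    (hω : ∀ g, ω g ∈ scaledIsometries i) (t : Z → G) (ht : ∀ x, Continuous fun z => i (ω (t z) x)) (f : H) :
    Continuous fun z => unitaryRep i hd ω hω (t z) f :=
  continuous_unitaryExt_apply i (fun z => ⟨ω (t z), hω (t z)⟩) hd ht f

end Continuity

end Literature.RepresentationTheory.Unitary

end
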